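import Mathlib
import HarnessLib
import Summits.RiemannHypothesis.Statement
import Summits.RiemannHypothesis.RiemannHypothesis.Theses.RuelleBand
import Summits.RiemannHypothesis.RiemannHypothesis.Theorems.IntegerScrewDefs
import Summits.RiemannHypothesis.RiemannHypothesis.Theorems.IntegerScrewNestedSylvester
import Summits.RiemannHypothesis.RiemannHypothesis.Theorems.IntegerScrewFiniteExceptionInertia
import Summits.RiemannHypothesis.RiemannHypothesis.Theorems.Splittings.CostumeDetectors
import Summits.RiemannHypothesis.RiemannHypothesis.Theorems.Splittings.BombieriFozNoDep
import Summits.RiemannHypothesis.RiemannHypothesis.Theorems.Splittings.ScrewBridgeRaw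
import Summits.RiemannHypothesis.RiemannHypothesis.Theorems.CofiniteCriticalLine.Negative.KiKimLeeEndpoint
import Summits.RiemannHypothesis.RiemannHypothesis.Theorems.CofiniteCriticalLine.Negative.KiKimLeeUniform
import Literature.Analysis.Matrix.KyFanMaximumPrinciple
import Literature.Analysis.Matrix.SylvesterInertiaCertificate
import Literature.Analysis.Matrix.EigenvalueCountOnSubspaces

/-!
# Cell rh-split, seat rh-split-screw-bridge gen 3 — definition-free raw form of the card addendum §8
# «the ∃-tail of the screw ladder is an INERTIA statement; the bridge FOZ ⟹ ETAIL reduced to named residuals»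

Raw (definition-free) companion of HOME/rh-split-screw-bridge/SplitScrewBridgeG3.lean for
HOME/cards/SPLIT-screw-bridge.md §8; sits after the landed `Splittings/ScrewBridgeRaw.lean` (gen 2), whose
`etail_detSign`, `eigenvalues_ne_zero_of_screwDet_ne_zero`, `etail_negIndex_parity_const` it uses.
Throughout, `n₋(n) := #{i | λ_i(screwMatrix n) < 0}` (negative eigenvalues with multiplicity) is written out
and ETAIL is `∃ M₀, ∀ M ≥ M₀, 0 < screwPivot M`.

* interlacing unit steps `n₋(n) ≤ n₋(N)` (`n ≤ N`) and `n₋(n+1) ≤ n₋(n) + 1` (PIVOT-LAW §11 Thm 3(ii)) from the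
  Literature inclusion principle `card_submatrix_eigenvalues_lt_le / _ge_le` [cite: HornJohnson2013, Thm 4.3.28];
* `etail_iff_boundedIndex_and_nonsingular`: ETAIL ⟺ (n₋ bounded) ∧ (screw matrices eventually nonsingular);
* the bridge `FOZ ⟹ ETAIL` and its converse with every modulus an explicit hypothesis: `etail_of_foz`,
  `converse_of_indexTransfer`, `etail_iff_foz_of_residuals`; the uniform Ki–Kim–Lee door `etail_of_uniform_kiKimLee`;
* negative eigen-frames (`frame_form_lt`, `exists_frame_of_card_le`: the converse half of the Courant–Fischer count)
  and the dedupe `boundedScrewIndex_tuple_iff` with SPLIT-screw-finite's tuple-form bounded index.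

Referee (rh-split-ref g0) addendum 2026-08-26T19:46Z on cards/SPLIT-screw-bridge.md §8: replay std on
`inertiaOfFoz_iff`; «interlacing kernel, ETAIL ⟺ bounded index ∧ nonsingular kernel, dictionary reduced exactly
to R1/R2/R3 open; class UNCHANGED» (barrier-note: the ∃-tail door is the FOZ costume; BombieriScrew = X-1 in
screw clothing, CONDITIONAL on `Bombieri2000.corollary11` and on the non-kernel ConverseInertia hypothesis).
Typer replays: rh-split-typer-2 g2 H1 19:46Z (std on `etail_iff_foz_of_residuals`), rh-split-typer-1 g2
19:55Z (farm rc 0, 0 warnings, 0 sorry; std on `etail_iff_foz_of_residuals`). Filed by rh-split-typer-1 g2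
on the lead's GO 19:39Z/19:40Z (HANDOFF-list item 7).

HONEST LABEL: SPLITTING SEARCH over kernel-typed RH-EQUIVALENCES; a splitting A ∧ B ⟹ RH is CONDITIONAL
bookkeeping unless A and B are both proved; nothing here bears on the truth of RH.
-/

set_option linter.dupNamespace false

noncomputable section

namespace Summit.RiemannHypothesis.RiemannHypothesis.Theorems.Splittings.ScrewBridgeRawG3

open Finset Matrix
open Literature.Analysis.Matrix Literature.Analysis.Matrix.KyFan
open Literature.Analysis.Matrix.EigenvalueCountOnSubspaces
open Literature.NumberTheory.LFunctions Literature.NumberTheory.LFunctions.Bombieri2000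
open Summit.RiemannHypothesis.RiemannHypothesis.Theses.RuelleBand
open Summit.RiemannHypothesis.RiemannHypothesis.Theorems.IntegerScrew
open Summit.RiemannHypothesis.RiemannHypothesis.Theorems.Splittings.CostumeDetectors
open Summit.RiemannHypothesis.RiemannHypothesis.Theorems.Splittings.BombieriFozNoDep
open Summit.RiemannHypothesis.RiemannHypothesis.Theorems.Splittings.ScrewBridgeRaw
open Summit.RiemannHypothesis.Cruxes.CofiniteCriticalLine.Negative

/-! ## §1 Interlacing unit steps for the negative index (PIVOT-LAW §11 Thm 3(ii)) -/

/-- Eigenvalue counts below a threshold depend only on the matrix. [folklore] -/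
theorem card_eig_lt_congr {m : Type*} [Fintype m] [DecidableEq m] {A B : Matrix m m ℝ} (hAB : A = B)
    (hA : A.IsHermitian) (hB : B.IsHermitian) (θ : ℝ) :
    (univ.filter fun i => hA.eigenvalues i < θ).card = (univ.filter fun i => hB.eigenvalues i < θ).card := by
  subst hAB; rfl

/-- Eigenvalue counts above a threshold depend only on the matrix. [folklore] -/
theorem card_eig_ge_congr {m : Type*} [Fintype m] [DecidableEq m] {A B : Matrix m m ℝ} (hAB : A = B)
    (hA : A.IsHermitian) (hB : B.IsHermitian) (θ : ℝ) :
    (univ.filter fun i => θ ≤ hA.eigenvalues i).card = (univ.filter fun i => θ ≤ hB.eigenvalues i).card := by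
  subst hAB; rfl

/-- Negative and non-negative eigenvalues exhaust the `n` eigenvalues of `screwMatrix n`. [folklore] -/
theorem negIndex_add_card_nonneg (n : ℕ) :
    (Finset.univ.filter fun i => (screwMatrix_isHermitian n).eigenvalues i < 0).card +
      (univ.filter fun i => 0 ≤ (screwMatrix_isHermitian n).eigenvalues i).card = n := by
  have h := Finset.card_filter_add_card_filter_not
    (s := (univ : Finset (Fin n))) (fun i => (screwMatrix_isHermitian n).eigenvalues i < 0)
  simp only [not_lt, card_univ, Fintype.card_fin] at h
  exact h

/-- **Interlacing, monotonicity in the level** (inclusion principle for the leading block):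
`n ≤ N ⟹ n₋(screwMatrix n) ≤ n₋(screwMatrix N)`. [cite: HornJohnson2013, Thm 4.3.28] -/
theorem negIndex_mono {n N : ℕ} (h : n ≤ N) :
    (Finset.univ.filter fun i => (screwMatrix_isHermitian n).eigenvalues i < 0).card ≤
      (Finset.univ.filter fun i => (screwMatrix_isHermitian N).eigenvalues i < 0).card := by
  have key := card_submatrix_eigenvalues_lt_le (screwMatrix_isHermitian N) (Fin.castLE_injective h) 0
  have hc := card_eig_lt_congr (screwMatrix_submatrix_castLE h)
    ((screwMatrix_isHermitian N).submatrix (Fin.castLE h)) (screwMatrix_isHermitian n) 0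
  rw [← hc]
  exact key

/-- **Interlacing, upper unit step** (bordering raises the negative index by at most one):
`n₋(screwMatrix (n+1)) ≤ n₋(screwMatrix n) + 1`. [cite: HornJohnson2013, Thm 4.3.28] -/
theorem negIndex_succ_le (n : ℕ) :
    (Finset.univ.filter fun i => (screwMatrix_isHermitian (n + 1)).eigenvalues i < 0).card ≤
      (Finset.univ.filter fun i => (screwMatrix_isHermitian n).eigenvalues i < 0).card + 1 := by
  have key := card_submatrix_eigenvalues_ge_le (screwMatrix_isHermitian (n + 1))
    (Fin.castLE_injective (Nat.le_succ n)) 0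
  have hc := card_eig_ge_congr (screwMatrix_submatrix_castLE (Nat.le_succ n))
    ((screwMatrix_isHermitian (n + 1)).submatrix (Fin.castLE (Nat.le_succ n))) (screwMatrix_isHermitian n) 0
  rw [hc] at key
  have h1 := negIndex_add_card_nonneg n
  have h2 := negIndex_add_card_nonneg (n + 1)
  omega

/-- A monotone bounded `ℕ`-valued sequence is eventually constant. [folklore] -/
theorem nat_eventually_const_of_monotone_bounded (f : ℕ → ℕ) (hmono : Monotone f) (hb : ∃ K, ∀ n, f n ≤ K) :
    ∃ N k, ∀ n, N ≤ n → f n = k := by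
  obtain ⟨K, hK⟩ := hb
  have hne : (Set.range f).Nonempty := ⟨_, 0, rfl⟩
  have hbdd : BddAbove (Set.range f) := ⟨K, by rintro _ ⟨n, rfl⟩; exact hK n⟩
  obtain ⟨N, hN⟩ := Nat.sSup_mem hne hbdd
  refine ⟨N, f N, fun n hn => le_antisymm ?_ (hmono hn)⟩
  rw [hN]
  exact le_csSup hbdd ⟨n, rfl⟩

/-- A sequence with no step beyond `N` is constant beyond `N`. [folklore] -/
theorem nat_const_of_succ_eq (f : ℕ → ℕ) (N : ℕ) (h : ∀ n, N ≤ n → f (n + 1) = f n) :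
    ∀ n, N ≤ n → f n = f N := by
  have key : ∀ d, f (N + d) = f N := by
    intro d
    induction d with
    | zero => rfl
    | succ d ih =>
      calc f (N + (d + 1)) = f (N + d + 1) := rfl
        _ = f (N + d) := h (N + d) (Nat.le_add_right N d)
        _ = f N := ih
  intro n hn
  obtain ⟨d, rfl⟩ := Nat.exists_eq_add_of_le hn
  exact key d

/-! ## §2 ETAIL ⟺ bounded negative index ∧ eventual nonsingularity -/

/-- **Under ETAIL the negative index is eventually stationary** (parity rung `etail_negIndex_parity_const` +
unit steps). [folklore] -/
theorem etail_negIndex_succ_eq (h : (∃ M₀ : ℕ, ∀ M : ℕ, M₀ ≤ M → 0 < screwPivot M)) :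
    ∃ N : ℕ, ∀ n : ℕ, N ≤ n →
      (Finset.univ.filter fun i => (screwMatrix_isHermitian (n + 1)).eigenvalues i < 0).card =
        (Finset.univ.filter fun i => (screwMatrix_isHermitian n).eigenvalues i < 0).card := by
  obtain ⟨N, hN⟩ := etail_negIndex_parity_const h
  refine ⟨N, fun n hn => ?_⟩
  have hpar := hN n hn
  have h1 : (Finset.univ.filter fun i => (screwMatrix_isHermitian n).eigenvalues i < 0).card ≤
      (Finset.univ.filter fun i => (screwMatrix_isHermitian (n + 1)).eigenvalues i < 0).card := negIndex_mono (Nat.le_succ n)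
  have h2 := negIndex_succ_le n
  rcases Nat.eq_or_lt_of_le h1 with heq | hlt
  · exact heq.symm
  · exfalso
    have heq : (Finset.univ.filter fun i => (screwMatrix_isHermitian (n + 1)).eigenvalues i < 0).card =
        (Finset.univ.filter fun i => (screwMatrix_isHermitian n).eigenvalues i < 0).card + 1 := by omega
    rw [heq, Nat.even_add_one] at hpar
    exact not_iff_self hpar

/-- **ETAIL ⟹ BOUNDED negative index** (SPLIT-screw-finite's `ETail → BoundedScrewIndex`, eigen-count form).
[folklore] -/
theorem etail_boundedIndex (h : (∃ M₀ : ℕ, ∀ M : ℕ, M₀ ≤ M → 0 < screwPivot M)) :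
    (∃ K : ℕ, ∀ n : ℕ, (Finset.univ.filter fun i => (screwMatrix_isHermitian n).eigenvalues i < 0).card ≤ K) := by
  obtain ⟨N, hN⟩ := etail_negIndex_succ_eq h
  have hc := nat_const_of_succ_eq (fun n => (Finset.univ.filter fun i => (screwMatrix_isHermitian n).eigenvalues i < 0).card) N hN
  refine ⟨(Finset.univ.filter fun i => (screwMatrix_isHermitian N).eigenvalues i < 0).card, fun n => ?_⟩
  rcases le_total N n with hn | hn
  · exact (hc n hn).le
  · exact negIndex_mono hn

/-- ETAIL ⟹ the screw matrices are eventually nonsingular. [folklore] -/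
theorem etail_eventuallyNonsingular (h : (∃ M₀ : ℕ, ∀ M : ℕ, M₀ ≤ M → 0 < screwPivot M)) :
    (∃ N : ℕ, ∀ n : ℕ, N ≤ n → screwDet n ≠ 0) :=
  (etail_detSign h).imp fun _ hN n hn => (hN n hn).1

/-- **Converse: a bounded negative index at eventually nonsingular levels gives ETAIL** (the index freezes;
a stationary index at nonsingular levels is a positive pivot, `screwPivot_pos_iff_even_iff_even`). [folklore] -/
theorem etail_of_boundedIndex_of_nonsingular (hb : (∃ K : ℕ, ∀ n : ℕ, (Finset.univ.filter fun i => (screwMatrix_isHermitian n).eigenvalues i < 0).card ≤ K))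
    (hns : (∃ N : ℕ, ∀ n : ℕ, N ≤ n → screwDet n ≠ 0)) : (∃ M₀ : ℕ, ∀ M : ℕ, M₀ ≤ M → 0 < screwPivot M) := by
  obtain ⟨N₁, k, hk⟩ := nat_eventually_const_of_monotone_bounded
    (fun n => (Finset.univ.filter fun i => (screwMatrix_isHermitian n).eigenvalues i < 0).card) (fun a b hab => negIndex_mono hab) hb
  obtain ⟨N₂, hN₂⟩ := hns
  refine ⟨N₁ + N₂ + 2, fun M hM => ?_⟩
  obtain ⟨n, rfl⟩ : ∃ n, M = n + 2 := ⟨M - 2, by omega⟩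
  have hn1 : N₁ ≤ n := by omega
  have hn2 : N₂ ≤ n := by omega
  rw [screwPivot_pos_iff_even_iff_even n
    (eigenvalues_ne_zero_of_screwDet_ne_zero (hN₂ n hn2))
    (eigenvalues_ne_zero_of_screwDet_ne_zero (hN₂ (n + 1) (by omega)))]
  have e1 := hk (n + 1) (by omega)
  have e0 := hk n hn1
  beta_reduce at e1 e0
  rw [e1, e0]

/-- **ETAIL ⟺ (bounded negative index) ∧ (eventual nonsingularity)**: the thresholdless tail of the pivot
ladder is an inertia statement about the nested screw Gram matrices (PIVOT-LAW §11 Thm 6 (b)⟺(c), the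
linear-algebra half). [folklore] -/
theorem etail_iff_boundedIndex_and_nonsingular :
    (∃ M₀ : ℕ, ∀ M : ℕ, M₀ ≤ M → 0 < screwPivot M) ↔
      (∃ K : ℕ, ∀ n : ℕ, (Finset.univ.filter fun i => (screwMatrix_isHermitian n).eigenvalues i < 0).card ≤ K) ∧
        (∃ N : ℕ, ∀ n : ℕ, N ≤ n → screwDet n ≠ 0) :=
  ⟨fun h => ⟨etail_boundedIndex h, etail_eventuallyNonsingular h⟩,
    fun h => etail_of_boundedIndex_of_nonsingular h.1 h.2⟩

/-! ## §3 The bridge `FOZ ⟹ ETAIL` and its converse with every modulus an explicit hypothesis -/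

/-- **The bridge, modulo its two residuals** R1 «FOZ bounds the negative index» (PIVOT-LAW Thm 3(i)) and
R2 «FOZ makes the screw matrices eventually nonsingular» (Thm 4): `R1 → R2 → (FOZ ⟹ ETAIL)`. -/
theorem etail_of_foz
    (h1 : CofiniteCriticalLine → (∃ K : ℕ, ∀ n : ℕ, (Finset.univ.filter fun i => (screwMatrix_isHermitian n).eigenvalues i < 0).card ≤ K))
    (h2 : CofiniteCriticalLine → (∃ N : ℕ, ∀ n : ℕ, N ≤ n → screwDet n ≠ 0))
    (hfoz : CofiniteCriticalLine) : (∃ M₀ : ℕ, ∀ M : ℕ, M₀ ≤ M → 0 < screwPivot M) :=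
  etail_of_boundedIndex_of_nonsingular (h1 hfoz) (h2 hfoz)

/-- **The reduction is exact**: `(FOZ ⟹ ETAIL) ⟺ R1 ∧ R2`. [folklore] -/
theorem inertiaOfFoz_iff :
    (CofiniteCriticalLine → (∃ M₀ : ℕ, ∀ M : ℕ, M₀ ≤ M → 0 < screwPivot M)) ↔
      (CofiniteCriticalLine → (∃ K : ℕ, ∀ n : ℕ, (Finset.univ.filter fun i => (screwMatrix_isHermitian n).eigenvalues i < 0).card ≤ K)) ∧
        (CofiniteCriticalLine → (∃ N : ℕ, ∀ n : ℕ, N ≤ n → screwDet n ≠ 0)) :=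
  ⟨fun h => ⟨fun hf => (etail_iff_boundedIndex_and_nonsingular.mp (h hf)).1,
      fun hf => (etail_iff_boundedIndex_and_nonsingular.mp (h hf)).2⟩,
    fun h hf => etail_of_foz h.1 h.2 hf⟩

/-- R3 «IndexTransfer» (a bounded negative index forces FOZ; PIVOT-LAW Lemma U) gives `ETAIL ⟹ FOZ`. -/
theorem converse_of_indexTransfer
    (hT : (∃ K : ℕ, ∀ n : ℕ, (Finset.univ.filter fun i => (screwMatrix_isHermitian n).eigenvalues i < 0).card ≤ K) → CofiniteCriticalLine)
    (het : (∃ M₀ : ℕ, ∀ M : ℕ, M₀ ≤ M → 0 < screwPivot M)) : CofiniteCriticalLine :=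
  hT (etail_boundedIndex het)

/-- `ETAIL ⟹ FOZ` is exactly index transfer AT eventually nonsingular ladders. [folklore] -/
theorem converseInertia_iff :
    ((∃ M₀ : ℕ, ∀ M : ℕ, M₀ ≤ M → 0 < screwPivot M) → CofiniteCriticalLine) ↔
      ((∃ K : ℕ, ∀ n : ℕ, (Finset.univ.filter fun i => (screwMatrix_isHermitian n).eigenvalues i < 0).card ≤ K) →
        (∃ N : ℕ, ∀ n : ℕ, N ≤ n → screwDet n ≠ 0) → CofiniteCriticalLine) :=
  ⟨fun h hb hns => h (etail_of_boundedIndex_of_nonsingular hb hns),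
    fun h het => h (etail_boundedIndex het) (etail_eventuallyNonsingular het)⟩

/-- T2 of the SPLITTING-MATRIX (`ETAIL ⟺ FERH`) with every modulus named: `R3 → R1 → R2 → (ETAIL ⟺ FOZ)`. -/
theorem etail_iff_foz_of_residuals
    (hT : (∃ K : ℕ, ∀ n : ℕ, (Finset.univ.filter fun i => (screwMatrix_isHermitian n).eigenvalues i < 0).card ≤ K) → CofiniteCriticalLine)
    (h1 : CofiniteCriticalLine → (∃ K : ℕ, ∀ n : ℕ, (Finset.univ.filter fun i => (screwMatrix_isHermitian n).eigenvalues i < 0).card ≤ K))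
    (h2 : CofiniteCriticalLine → (∃ N : ℕ, ∀ n : ℕ, N ≤ n → screwDet n ≠ 0)) :
    (∃ M₀ : ℕ, ∀ M : ℕ, M₀ ≤ M → 0 < screwPivot M) ↔ CofiniteCriticalLine :=
  ⟨converse_of_indexTransfer hT, etail_of_foz h1 h2⟩

/-- RH makes all three residuals true. [folklore] -/
theorem residuals_of_rh (h : _root_.RiemannHypothesis) :
    ((∃ K : ℕ, ∀ n : ℕ, (Finset.univ.filter fun i => (screwMatrix_isHermitian n).eigenvalues i < 0).card ≤ K) → CofiniteCriticalLine) ∧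
      (CofiniteCriticalLine → (∃ K : ℕ, ∀ n : ℕ, (Finset.univ.filter fun i => (screwMatrix_isHermitian n).eigenvalues i < 0).card ≤ K)) ∧
        (CofiniteCriticalLine → (∃ N : ℕ, ∀ n : ℕ, N ≤ n → screwDet n ≠ 0)) :=
  ⟨fun _ => cofiniteCriticalLine_of_rh h, fun _ => etail_boundedIndex (etailScrew_of_rh h),
    fun _ => etail_eventuallyNonsingular (etailScrew_of_rh h)⟩

/-- **Uniform Ki–Kim–Lee ⟹ ETAIL, modulo R1 ∧ R2**: a threshold for the reality of the large zeros of the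
de Bruijn family `H_t` uniform in `t ∈ (0, δ)` passes to `t = 0` (tree `kiKimLee_at_zero_of_uniform`), i.e.
gives FOZ (`cofiniteCriticalLine_iff_kiKimLee_at_zero`), hence the screw ∃-tail. [cite: KiKimLee2009, Thm. 1.3] -/
theorem etail_of_uniform_kiKimLee
    (h1 : CofiniteCriticalLine → (∃ K : ℕ, ∀ n : ℕ, (Finset.univ.filter fun i => (screwMatrix_isHermitian n).eigenvalues i < 0).card ≤ K))
    (h2 : CofiniteCriticalLine → (∃ N : ℕ, ∀ n : ℕ, N ≤ n → screwDet n ≠ 0))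
    {T δ : ℝ} (hδ : 0 < δ)
    (h : ∀ t : ℝ, 0 < t → t < δ → ∀ z : ℂ, deBruijnH t z = 0 → T ≤ |z.re| → z.im = 0) :
    (∃ M₀ : ℕ, ∀ M : ℕ, M₀ ≤ M → 0 < screwPivot M) :=
  etail_of_foz h1 h2 (cofiniteCriticalLine_iff_kiKimLee_at_zero.2 ⟨T + 1, kiKimLee_at_zero_of_uniform hδ h⟩)

/-- «BombieriScrew» with its modulus named R3: `R3 → corollary11 → ETAIL → NoDep ((log 2)/2) → RH`.
[cite: Bombieri2000Weil, Corollary to Thm. 11 (p. 37)] -/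
theorem rh_of_etail_noDep_yoshida
    (hT : (∃ K : ℕ, ∀ n : ℕ, (Finset.univ.filter fun i => (screwMatrix_isHermitian n).eigenvalues i < 0).card ≤ K) → CofiniteCriticalLine)
    (h11 : corollary11) (het : (∃ M₀ : ℕ, ∀ M : ℕ, M₀ ≤ M → 0 < screwPivot M))
    (hdep : NoDep (Real.log 2 / 2)) : _root_.RiemannHypothesis :=
  rh_of_foz_noDep_yoshida h11 (converse_of_indexTransfer hT het) hdep

/-! ## §4 Negative eigen-frames and the dedupe with SPLIT-screw-finite's tuple-form bounded index -/

section Frames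

variable {ι : Type*} [Fintype ι] [DecidableEq ι] {κ : Type*} [Fintype κ]

/-- Eigen-coordinates of a combination of eigenvectors: `u_{e b} ⬝ Σ c_{b'} u_{e b'} = c_b`. [folklore] -/
theorem eigvec_dotProduct_sum_smul {W : Matrix ι ι ℝ} (hW : W.IsHermitian) {e : κ → ι}
    (he : Function.Injective e) (c : κ → ℝ) (b : κ) :
    (hW.eigenvectorBasis (e b)).ofLp ⬝ᵥ (∑ b', c b' • (hW.eigenvectorBasis (e b')).ofLp) = c b := by
  rw [dotProduct_sum]
  simp_rw [dotProduct_smul, smul_eq_mul, eigenvectorBasis_dotProduct]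
  rw [Finset.sum_eq_single b]
  · simp
  · intro b' _ hb'
    rw [if_neg (fun h => hb' (he h).symm), mul_zero]
  · intro h
    exact absurd (Finset.mem_univ b) h

/-- … and `u_i ⬝ Σ c_{b'} u_{e b'} = 0` for `i` outside the frame. [folklore] -/
theorem eigvec_dotProduct_sum_smul_of_notMem {W : Matrix ι ι ℝ} (hW : W.IsHermitian) {e : κ → ι}
    (c : κ → ℝ) {i : ι} (hi : ∀ b, e b ≠ i) :
    (hW.eigenvectorBasis i).ofLp ⬝ᵥ (∑ b', c b' • (hW.eigenvectorBasis (e b')).ofLp) = 0 := by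
  rw [dotProduct_sum]
  refine Finset.sum_eq_zero fun b' _ => ?_
  rw [dotProduct_smul, smul_eq_mul, eigenvectorBasis_dotProduct, if_neg (fun h => hi b' h.symm), mul_zero]

/-- **A frame of eigenvectors with eigenvalues below `θ` is strictly `θ`-negative**: every non-trivial
combination `x` has `xᵀWx < θ‖x‖²`. [cite: HornJohnson2013, Thm 4.1.5 with (4.2.2)] -/
theorem frame_form_lt {W : Matrix ι ι ℝ} (hW : W.IsHermitian) {e : κ → ι} (he : Function.Injective e)
    {θ : ℝ} (hlt : ∀ b, hW.eigenvalues (e b) < θ) {c : κ → ℝ} (hc : c ≠ 0) :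
    (∑ b, c b • (hW.eigenvectorBasis (e b)).ofLp) ⬝ᵥ W *ᵥ (∑ b, c b • (hW.eigenvectorBasis (e b)).ofLp) <
      θ * ((∑ b, c b • (hW.eigenvectorBasis (e b)).ofLp) ⬝ᵥ
        (∑ b, c b • (hW.eigenvectorBasis (e b)).ofLp)) := by
  set x := ∑ b, c b • (hW.eigenvectorBasis (e b)).ofLp with hx
  obtain ⟨b₀, hb₀⟩ : ∃ b, c b ≠ 0 := by
    by_contra h
    push Not at h
    exact hc (funext h)
  rw [dotProduct_mulVec_eq_sum_eigen hW x, dotProduct_self_eq_sum_sq hW x, Finset.mul_sum, ← sub_pos,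
    ← Finset.sum_sub_distrib]
  have hterm : ∀ i, 0 ≤ θ * ((hW.eigenvectorBasis i).ofLp ⬝ᵥ x) ^ 2 -
      hW.eigenvalues i * ((hW.eigenvectorBasis i).ofLp ⬝ᵥ x) ^ 2 := by
    intro i
    by_cases hi : ∃ b, e b = i
    · obtain ⟨b, rfl⟩ := hi
      rw [← sub_mul]
      exact mul_nonneg (sub_nonneg.2 (hlt b).le) (sq_nonneg _)
    · push Not at hi
      rw [hx, eigvec_dotProduct_sum_smul_of_notMem hW c hi]
      simp
  calc (0 : ℝ) < θ * ((hW.eigenvectorBasis (e b₀)).ofLp ⬝ᵥ x) ^ 2 -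
        hW.eigenvalues (e b₀) * ((hW.eigenvectorBasis (e b₀)).ofLp ⬝ᵥ x) ^ 2 := by
        rw [← sub_mul, hx, eigvec_dotProduct_sum_smul hW he c b₀]
        exact mul_pos (sub_pos.2 (hlt b₀)) (by positivity)
    _ ≤ ∑ i, (θ * ((hW.eigenvectorBasis i).ofLp ⬝ᵥ x) ^ 2 -
        hW.eigenvalues i * ((hW.eigenvectorBasis i).ofLp ⬝ᵥ x) ^ 2) :=
        Finset.single_le_sum (fun i _ => hterm i) (Finset.mem_univ (e b₀))

/-- **Count ⟹ frame** (the converse half of the Courant–Fischer count): if at least `|κ|` eigenvalues lie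
below `θ`, there is a `κ`-frame on which the form is strictly `θ`-negative. [folklore] -/
theorem exists_frame_of_card_le {W : Matrix ι ι ℝ} (hW : W.IsHermitian) {θ : ℝ}
    (h : Fintype.card κ ≤ (univ.filter fun i => hW.eigenvalues i < θ).card) :
    ∃ v : κ → (ι → ℝ), ∀ c : κ → ℝ, c ≠ 0 →
      (∑ b, c b • v b) ⬝ᵥ W *ᵥ (∑ b, c b • v b) < θ * ((∑ b, c b • v b) ⬝ᵥ (∑ b, c b • v b)) := by
  classical
  have hcard : Fintype.card κ ≤ Fintype.card {i // hW.eigenvalues i < θ} := by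
    rwa [Fintype.card_subtype]
  obtain ⟨f⟩ := Function.Embedding.nonempty_of_card_le hcard
  refine ⟨fun b => (hW.eigenvectorBasis (f b).1).ofLp, fun c hc => ?_⟩
  exact frame_form_lt hW (e := fun b => (f b).1) (Subtype.val_injective.comp f.injective) (fun b => (f b).2) hc

end Frames

/-- **DEDUPE: SPLIT-screw-finite's tuple-form `BoundedScrewIndex` is the eigen-count bound.**
(←) the Courant–Fischer certificate `EigenvalueCount.card_le_card_eigenvalues_lt`; (→) negative eigen-frames.
[folklore] -/
theorem boundedScrewIndex_tuple_iff :
    (∃ N : ℕ, ∀ n : ℕ, ∀ v : Fin (N + 1) → (Fin n → ℝ),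
      ∃ c : Fin (N + 1) → ℝ, c ≠ 0 ∧
        0 ≤ star (∑ i, c i • v i) ⬝ᵥ ((screwMatrix n).mulVec (∑ i, c i • v i))) ↔
    (∃ K : ℕ, ∀ n : ℕ, (Finset.univ.filter fun i => (screwMatrix_isHermitian n).eigenvalues i < 0).card ≤ K) := by
  constructor
  · rintro ⟨N, hN⟩
    refine ⟨N, fun n => ?_⟩
    by_contra hlt
    rw [not_le] at hlt
    have hle : Fintype.card (Fin (N + 1)) ≤
        (univ.filter fun i => (screwMatrix_isHermitian n).eigenvalues i < 0).card := by
      rw [Fintype.card_fin]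
      exact hlt
    obtain ⟨v, hv⟩ := exists_frame_of_card_le (screwMatrix_isHermitian n) hle
    obtain ⟨c, hc, hge⟩ := hN n v
    have h := hv c hc
    rw [zero_mul] at h
    rw [star_trivial] at hge
    exact absurd hge (not_le.mpr h)
  · rintro ⟨K, hK⟩
    refine ⟨K, fun n v => ?_⟩
    by_contra hno
    push Not at hno
    set V : Matrix (Fin n) (Fin (K + 1)) ℝ := Matrix.of fun a b => v b a with hVdef
    have hV : ∀ c : Fin (K + 1) → ℝ, V *ᵥ c = ∑ b, c b • v b := by
      intro c
      ext a
      simp [hVdef, Matrix.mulVec, dotProduct, Finset.sum_apply, Pi.smul_apply, mul_comm]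
    have key := EigenvalueCount.card_le_card_eigenvalues_lt (screwMatrix_isHermitian n) V (θ := 0)
      (fun c hc => by
        rw [zero_mul, hV]
        have := hno c hc
        rwa [star_trivial] at this)
    rw [Fintype.card_fin] at key
    have := hK n
    omega

end Summit.RiemannHypothesis.RiemannHypothesis.Theorems.Splittings.ScrewBridgeRawG3

end
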